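/-
COR-CM (cell pub-hodgecm2, stage 2 of the Hodge ladder) — Δ2 BRIDGE, J-column junction J2 ⇄ J3: the ONE law the `hfaith` leg of the
pin's `Map43RationalData.P_injective` needs from the Albanese-on-pieces construction (`CorCM/D2Bridge/AlbaneseOnPieceCore.lean`,
J2) — «a homomorphism `φ : Alb_{X} → B` OVER `k` whose complexification kills every `ψ_c : J(Y_c) → Alb_X ⊗_k ℂ` (`albDesc`) is
zero» — REDUCED to the purely geometric statement that the self-products `Y_c × Y_c` of the pieces jointly cover `(∇X)_ℂ`
(hypothesis `hN`, resp. the colimit-cofan form).  Seat prover-pub-hodgecm2-d2bridge-prove-3-g0-0 (d2bridge-prove-3, J3 owner).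
THEOREMS ONLY; no `sorry`; hole-free imports (no `HodgeCM.Model.*`, no manifest path).  HC_CM is NOT proved; nothing here is a
display or a pointer move.
-/
import Summits.HodgeConjecture.CorCM.D2Bridge.AlbaneseOnPieceCore
import Literature.AlgebraicGeometry.Motives.AbelianVarietyFrobeniusDescent
import Literature.AlgebraicGeometry.ComplexMultiplication.EndAlgebraCommSubalgebraDegreeBound
import HarnessLib

/-!
# Δ2 bridge, J2 ⇄ J3: homomorphisms out of `Alb_X` are detected on the pieces' Jacobians — modulo «`∐_c Y_c × Y_c ↠ (∇X)_ℂ`»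

Setting of `AlbaneseOnPieceCore`: `k` a field with `[Algebra k ℂ]`, `X : SchemeOver k`, `a : Albanese X` ANY Albanese datum
([Liu2021] Def. 2.3: `α_X : ∇X → Alb_X` corepresenting), pieces `inj c : Y c ⟶ X ⊗_k ℂ` geometrically irreducible, Jacobian data
`𝒥 c` of the pieces, and J2's `albDesc a (inj c) (𝒥 c) : J(Y_c) ⟶ Alb_X ⊗_k ℂ` (the homomorphism through which `α_X|_{Y_c × Y_c}`
factors).  The J3 detection lemma (`CorCM/D2Bridge/HcmJ3PullbackDetects.lean`) consumes «the `albDesc` are jointly epimorphic»;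
what the pin's `hfaith` actually needs is that clause for COMPLEXIFIED homomorphisms `w = φ ⊗ ℂ`, `φ : Alb_X → B` over `k`
(`B = A_μ`), and for those it follows from Liu's universal property OVER `k`:

* `AbelianVariety.zero_hom_hom_hom` — the zero homomorphism's underlying morphism is the unit point (unfolding).
* `Albanese.eq_zero_of_α_comp_eq_one` — `φ : Alb_X → B` with `α_X ≫ φ` trivial is zero (uniqueness half of Def. 2.3).
* `eq_zero_of_albDesc_comp_baseChange_eq_zero` — **if the lifts `nablaLiftPiece a (inj c) : Y_c × Y_c ⟶ (∇X)_ℂ` are jointly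
  epimorphic** (`hN`) then `(∀ c, albDesc_c ≫ φ_ℂ = 0) → φ = 0`: on each `Y_c × Y_c`, `α_ℂ ≫ φ_ℂ = diff ≫ albDesc_c ≫ φ_ℂ` is trivial,
  so `α_ℂ ≫ φ_ℂ = (α ≫ φ)_ℂ` is trivial by `hN`; base change of `k`-schemes is faithful (`AbelianVariety.faithful_bcFunctor`,
  faithfully flat descent of morphisms), so `α ≫ φ` is trivial; conclude by the universal property.
* `eq_zero_of_albDesc_comp_baseChange_eq_zero_of_isColimit` — the same from the colimit-cofan form
  «`(∇X)_ℂ = ∐_c Y_c × Y_c`» (Mathlib `Cofan.IsColimit.hom_ext`).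
* `exists_albDesc_comp_baseChange_ne_zero` ∕ `exists_pull_abelJacobi_albDesc_baseChange_ne_zero` — the `hfaith` shapes: a non-zero
  `φ` has a piece with `albDesc_c ≫ φ_ℂ ≠ 0`, and (Lemma 2.4 (1) currency: `(f^{P_c})^*` injective on `H¹`) with
  `(f^{P_c} ≫ albDesc_c ≫ φ_ℂ)^* ≠ 0` on `H¹(B(ℂ); ℚ)` (the rational representation is faithful,
  `ComplexMultiplication.hom_eq_zero_of_bettiCohomology_map_one_eq_zero`).

What remains for the J2 lineage is exactly `hN`: `(∇X)_ℂ` is covered by the `Y_c × Y_c` — i.e. «`(∇X) ⊗_k ℂ = ∇(X ⊗_k ℂ)`»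
for the decomposition into connected components ([Liu2021] §2.1, used silently in the proof of Lemma 2.4 (1), l. 1220–1228; the
tree has the inclusion `Y_c × Y_c ⊆ (∇X)_ℂ`, `range_tensorHom_μ_subset_range`, and the finite-Galois descent of `∇`,
`Liu2021/NablaGaloisDescent`).  HC_CM is NOT proved.

## References
* [Liu2021] Y. Liu, *Fourier–Jacobi cycles and arithmetic relative trace formula*, Camb. J. Math. 9 (2021) = arXiv:2102.11518:
  §2.1 Def. 2.1 (1) (FJcycle.tex l. 1171–1174), Def. 2.3 with the Proposition (l. 1190–1208), proof of Lemma 2.4 (1) (l. 1220–1228);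
  proof of Thm. 4.18 (l. 2248–2250: «by pulling back … injective»).
* [GortzWedhorn2020] U. Görtz, T. Wedhorn, *Algebraic Geometry I*, 2nd ed., Theorem 14.72 (1) (faithfully flat descent of morphisms).
* [Milne1986JacobianVarieties] J. S. Milne, *Jacobian Varieties* (1986), §6 Prop. 6.1, 6.4.
-/

set_option autoImplicit false

noncomputable section

open CategoryTheory CategoryTheory.Limits AlgebraicGeometry MonoidalCategory CartesianMonoidalCategory
open Function
open Literature.AlgebraicGeometry.Motives
open Literature.AlgebraicGeometry.HodgeTheory
open Literature.NumberTheory.Automorphic.Liu2021.AppendixC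
open scoped MonObj

/-! ## Two unfoldings over a general field -/

namespace Literature.AlgebraicGeometry.Motives.AbelianVariety

/-- The zero homomorphism of abelian varieties has the unit point as underlying morphism of schemes: `(0 : A → B) = (x ↦ 0_B)`.
Unfolding of the tree's conventions (`hom_zero`, Mathlib `Grp.Hom.hom_one`, `Mon.Hom.hom_one`). [folklore] -/
theorem zero_hom_hom_hom {K : Type} [Field K] {A B : AbelianVariety K} : (0 : A ⟶ B).hom.hom.hom = 1 := by
  rw [hom_zero, Grp.Hom.hom_one, Mon.Hom.hom_one]

/-- The underlying morphism of a composite of homomorphisms is the composite of the underlying morphisms. [folklore] -/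
theorem comp_hom_hom_hom {K : Type} [Field K] {A B C : AbelianVariety K} (f : A ⟶ B) (g : B ⟶ C) :
    (f ≫ g).hom.hom.hom = f.hom.hom.hom ≫ g.hom.hom.hom := rfl

end Literature.AlgebraicGeometry.Motives.AbelianVariety

namespace Literature.NumberTheory.Automorphic.Liu2021.AppendixC.Albanese

/-- **A homomorphism out of `Alb_X` is zero as soon as its composite with the Albanese morphism is trivial** (uniqueness half of
the corepresentability, [Liu2021] Def. 2.3: both `φ` and `0` are the descent of the trivial map `∇X → B`). [cite: Liu2021, Def. 2.3 with the Proposition (FJcycle.tex l. 1190–1208)] -/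
theorem eq_zero_of_α_comp_eq_one {k : Type} [Field k] {X : SchemeOver k} (a : Albanese X) {B : AbelianVariety k}
    (φ : a.Alb ⟶ B) (h : a.α ≫ φ.hom.hom.hom = 1) : φ = 0 :=
  a.hom_ext φ 0 (by rw [h, AbelianVariety.zero_hom_hom_hom, MonObj.comp_one])

end Literature.NumberTheory.Automorphic.Liu2021.AppendixC.Albanese

namespace Summit.HodgeConjecture.CorCM.D2Bridge

open AbelianVariety (bcSpec bcFunctor)

variable {k : Type} [Field k] [Algebra k ℂ] {X : SchemeOver k} (a : Albanese X)
  {κ : Type*} {Y : κ → SchemeOver ℂ} (inj : ∀ c, Y c ⟶ (bcFunctor k ℂ).obj X)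
  [∀ c, GeometricallyIrreducible (Y c).hom] (𝒥 : ∀ c, Jacobian (Y c))

/-! ## On each piece, `α_ℂ ≫ φ_ℂ` is trivial when `albDesc_c ≫ φ_ℂ = 0` -/

/-- On the self-product of a piece: if `ψ_c ≫ φ_ℂ = 0` then `(Y_c × Y_c → (∇X)_ℂ) ≫ α_ℂ ≫ φ_ℂ` is the unit point
(`α|_{Y_c × Y_c} = diff ≫ ψ_c`, `Jacobian.fac`). [cite: Milne1986JacobianVarieties, §6 Prop. 6.4] [cite: Liu2021, proof of Lemma 2.4 (1) (FJcycle.tex l. 1220–1226)] -/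
theorem nablaLiftPiece_alphaBC_baseChange_eq_one (c : κ) {B : AbelianVariety k} (φ : a.Alb ⟶ B)
    (h : albDesc a (inj c) (𝒥 c) ≫ AbelianVariety.Hom.baseChange ℂ φ = 0) :
    nablaLiftPiece a (inj c) ≫ alphaBC a ≫ (AbelianVariety.Hom.baseChange ℂ φ).hom.hom.hom = 1 := by
  rw [← Category.assoc, ← albPair_def, ← diff_albDesc, Category.assoc, ← AbelianVariety.comp_hom_hom_hom, h,
    AbelianVariety.zero_hom_hom_hom, MonObj.comp_one]

/-! ## The reduction: jointly epimorphic pieces of `(∇X)_ℂ` ⇒ `φ` is detected on the `albDesc` -/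

/-- **Homomorphisms `φ : Alb_X → B` over `k` are detected, after complexification, on the pieces' Jacobians — given that the
`Y_c × Y_c` jointly cover `(∇X)_ℂ`.**  If the lifts `nablaLiftPiece a (inj c) : Y_c × Y_c ⟶ (∇X)_ℂ` are jointly epimorphic (`hN`)
and `albDesc_c ≫ φ_ℂ = 0` for every `c`, then `φ = 0`: `α_ℂ ≫ φ_ℂ` is trivial on every piece, hence trivial (`hN`); it is the base
change of `α ≫ φ`, and base change of `k`-schemes along `k → ℂ` is faithful (faithfully flat descent of morphisms,
`AbelianVariety.faithful_bcFunctor`), so `α ≫ φ` is trivial and `φ = 0` by the universal property of `Alb_X` over `k`.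
[cite: Liu2021, Def. 2.3 with the Proposition (FJcycle.tex l. 1190–1208) and proof of Lemma 2.4 (1) (l. 1220–1228)]
[cite: GortzWedhorn2020, Theorem 14.72 (1)] -/
theorem eq_zero_of_albDesc_comp_baseChange_eq_zero
    (hN : ∀ {Z : SchemeOver ℂ} (f g : (bcFunctor k ℂ).obj a.nabla.N ⟶ Z),
      (∀ c, nablaLiftPiece a (inj c) ≫ f = nablaLiftPiece a (inj c) ≫ g) → f = g)
    {B : AbelianVariety k} (φ : a.Alb ⟶ B) (h : ∀ c, albDesc a (inj c) (𝒥 c) ≫ AbelianVariety.Hom.baseChange ℂ φ = 0) :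
    φ = 0 := by
  -- `α_ℂ ≫ φ_ℂ` is the unit point of `B_ℂ` on `(∇X)_ℂ`
  have h1 : alphaBC a ≫ (AbelianVariety.Hom.baseChange ℂ φ).hom.hom.hom =
      (1 : (bcFunctor k ℂ).obj a.nabla.N ⟶ (B.baseChange ℂ).X) :=
    hN _ _ fun c => by rw [nablaLiftPiece_alphaBC_baseChange_eq_one a inj 𝒥 c φ (h c), MonObj.comp_one]
  -- un-base-change: `α ≫ φ` is the unit point of `B` on `∇X`
  have h2 : a.α ≫ φ.hom.hom.hom = 1 := by
    apply (bcFunctor k ℂ).map_injective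
    rw [Functor.map_comp, Functor.map_one]
    exact h1
  exact Albanese.eq_zero_of_α_comp_eq_one a φ h2

/-- **The same from the coproduct form «`(∇X)_ℂ = ∐_c (Y_c × Y_c)`»**: if the `nablaLiftPiece a (inj c)` form a colimit cofan
then they are jointly epimorphic (Mathlib `Cofan.IsColimit.hom_ext`). [cite: Liu2021, §2.1 Def. 2.1 (1) (FJcycle.tex l. 1171–1174) and proof of Lemma 2.4 (1) (l. 1220–1228)] -/
theorem eq_zero_of_albDesc_comp_baseChange_eq_zero_of_isColimit
    (hcol : IsColimit (Cofan.mk ((bcFunctor k ℂ).obj a.nabla.N) fun c => nablaLiftPiece a (inj c)))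
    {B : AbelianVariety k} (φ : a.Alb ⟶ B) (h : ∀ c, albDesc a (inj c) (𝒥 c) ≫ AbelianVariety.Hom.baseChange ℂ φ = 0) :
    φ = 0 :=
  eq_zero_of_albDesc_comp_baseChange_eq_zero a inj 𝒥 (fun f g hfg => Cofan.IsColimit.hom_ext hcol f g hfg) φ h

/-! ## The `hfaith` shapes -/

/-- **A non-zero `φ : Alb_X → B` over `k` is non-zero on some piece's Jacobian after complexification** (given `hN`).
[cite: Liu2021, proof of Thm. 4.18 (FJcycle.tex l. 2248–2250) with proof of Lemma 2.4 (1) (l. 1220–1228)] -/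
theorem exists_albDesc_comp_baseChange_ne_zero
    (hN : ∀ {Z : SchemeOver ℂ} (f g : (bcFunctor k ℂ).obj a.nabla.N ⟶ Z),
      (∀ c, nablaLiftPiece a (inj c) ≫ f = nablaLiftPiece a (inj c) ≫ g) → f = g)
    {B : AbelianVariety k} (φ : a.Alb ⟶ B) (hφ : φ ≠ 0) :
    ∃ c, albDesc a (inj c) (𝒥 c) ≫ AbelianVariety.Hom.baseChange ℂ φ ≠ 0 := by
  by_contra hc
  exact hφ (eq_zero_of_albDesc_comp_baseChange_eq_zero a inj 𝒥 hN φ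
    fun c => Classical.byContradiction fun hne => hc ⟨c, hne⟩)

/-- **Pull-back form (Lemma 2.4 (1) currency)**: with `(f^{P_c})^*` injective on `H¹(J(Y_c)(ℂ); ℚ)` for the chosen base points
(at the pin: `Model.isIso_bettiCohomology_map_abelJacobi_pms`, resp. the ball data of the pieces), a non-zero `φ : Alb_X → B` over
`k` has a piece with `(f^{P_c} ≫ ψ_c ≫ φ_ℂ)^* ≠ 0` on `H¹(B(ℂ); ℚ)` — i.e. `(α_X)_{P_c}|_{Y_c}^* ∘ φ_ℂ^* ≠ 0`
(`albOnPiece_eq_abelJacobi_comp`); the rational representation of complex abelian varieties is faithful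
(`ComplexMultiplication.hom_eq_zero_of_bettiCohomology_map_one_eq_zero`).  This is the `hfaith` leg of the pin's `P_injective`
modulo `hN`. [cite: Liu2021, proof of Thm. 4.18 (FJcycle.tex l. 2248–2250) and Lemma 2.4 (1) (l. 1213, proof l. 1220–1228)] -/
theorem exists_pull_abelJacobi_albDesc_baseChange_ne_zero
    (hN : ∀ {Z : SchemeOver ℂ} (f g : (bcFunctor k ℂ).obj a.nabla.N ⟶ Z),
      (∀ c, nablaLiftPiece a (inj c) ≫ f = nablaLiftPiece a (inj c) ≫ g) → f = g)
    (P : ∀ c, AlgPoints (Y c) ℂ) (hinj : ∀ c, Injective (BettiUniverse.pull ((𝒥 c).abelJacobi (P c)) 1))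
    {B : AbelianVariety k} (φ : a.Alb ⟶ B) (hφ : φ ≠ 0) :
    ∃ c, BettiUniverse.pull
      ((𝒥 c).abelJacobi (P c) ≫ (albDesc a (inj c) (𝒥 c) ≫ AbelianVariety.Hom.baseChange ℂ φ).hom.hom.hom) 1 ≠ 0 := by
  obtain ⟨c, hc⟩ := exists_albDesc_comp_baseChange_ne_zero a inj 𝒥 hN φ hφ
  refine ⟨c, fun h0 => hc ?_⟩
  apply Literature.AlgebraicGeometry.ComplexMultiplication.hom_eq_zero_of_bettiCohomology_map_one_eq_zero
  apply LinearMap.ext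
  intro x
  apply hinj c
  have hx := LinearMap.congr_fun h0 x
  rw [BettiUniverse.pull_comp, LinearMap.comp_apply, LinearMap.zero_apply] at hx
  rw [LinearMap.zero_apply, map_zero]
  exact hx

/-- The same in Liu's `(α_X)_x|_{X_c}` spelling: `(albOnPiece a (inj c) (P c) ≫ φ_ℂ)^* ≠ 0` for some piece
(`albOnPiece_eq_abelJacobi_comp`). [cite: Liu2021, proof of Thm. 4.18 (FJcycle.tex l. 2248–2250) and proof of Lemma 2.4 (1) (l. 1220–1228)] -/
theorem exists_pull_albOnPiece_baseChange_ne_zero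
    (hN : ∀ {Z : SchemeOver ℂ} (f g : (bcFunctor k ℂ).obj a.nabla.N ⟶ Z),
      (∀ c, nablaLiftPiece a (inj c) ≫ f = nablaLiftPiece a (inj c) ≫ g) → f = g)
    (P : ∀ c, AlgPoints (Y c) ℂ) (hinj : ∀ c, Injective (BettiUniverse.pull ((𝒥 c).abelJacobi (P c)) 1))
    {B : AbelianVariety k} (φ : a.Alb ⟶ B) (hφ : φ ≠ 0) :
    ∃ c, BettiUniverse.pull (albOnPiece a (inj c) (P c) ≫ (AbelianVariety.Hom.baseChange ℂ φ).hom.hom.hom) 1 ≠ 0 := by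
  obtain ⟨c, hc⟩ := exists_pull_abelJacobi_albDesc_baseChange_ne_zero a inj 𝒥 hN P hinj φ hφ
  refine ⟨c, ?_⟩
  rwa [albOnPiece_eq_abelJacobi_comp a (inj c) (𝒥 c) (P c), Category.assoc, ← AbelianVariety.comp_hom_hom_hom]

end Summit.HodgeConjecture.CorCM.D2Bridge

end
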